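import Mathlib
import HarnessLib
import Summits.NavierStokesRegularity.NavierStokesRegularity.Theorems.TaylorModelRungThreeCertificateFormatVGrowthCPairs
import Summits.NavierStokesRegularity.NavierStokesRegularity.Theorems.TaylorModelRungThreeCertificateFormatVGrowthSound

/-!
# Crux K1b-DR (stmt-NavierStokesRegularity-23954), line `taylor-model` — v3 growth checker VARIANT C, SOUNDNESS part 3:
# (R2) with interval chunk transfers, and the composer's inputs for all stages (tm-g4 g5)

**`transport_boundC`** — an admissible chain from `s₀` (chunk `c = s₀/L`) to the start `qL` of a later chunk `q` maps the
`r·ω`-ball into the box `r·wVecC j L q s₀`: leg 1 over the rest of chunk `c` by the verified start-vector claim `ũ_{s₀}` (as v1),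
leg 2 over the chunks `c+1, …, q−1` as ONE kernel whose coordinate matrix lies in the interval product `RS j q (q−1−c)` of the
verified transfer claims (`memMat_RS`; cancellation across those chunks retained), then one magnitude (`absLeW_kiter_of_prodMem`).
**`hR2_inChunkC`**, **`hR2_crossC`**, **`hR2_of_growthC`** — clause (R2) for all pairs with `G := GrC`; `hR2_allC`, `hR3a_allC`,
`hR3b_allC`, `steps_of_growthC` — the inputs of `k1bDR_of_checksVR'` (binders verbatim as in `…FormatVGrowthSound`; (R0)/(R1)
are v1's `hR0_all`/`hR1_all`, unchanged). MODEL-lattice bookkeeping only (rung TL-M3); nothing here is a statement about the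
Navier–Stokes equations; K1b-DR is NOT proved here (that needs an emitted certificate whose Booleans evaluate to `true`).
-/

-- the sub-problem namespace repeats the summit name by design (D-0017)
set_option linter.dupNamespace false

namespace Summit.NavierStokesRegularity.NavierStokesRegularity.Theorems.TaylorModelCert

open scoped BigOperators
open Literature.Analysis.FluidPDE.TaoCascade Literature.Analysis.FluidPDE.TaoCascade.TaylorChain
open Summit.NavierStokesRegularity.NavierStokesRegularity.Theorems.TaylorModelReadout
open Summit.NavierStokesRegularity.NavierStokesRegularity.Theorems.TaylorModelV

/-- Row sums of magnitudes against a dyadic vector are below the upward product `(|P|·u)↑`. [folklore] -/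
theorem sum_mag_le_absMulVecUp {n : ℕ} (prec : ℕ) (P : Array (Array IntervalD)) (u : Array Dyad) {r' : ℕ} (hr' : r' < n) :
    ∑ t ∈ Finset.range n, (IntervalD.mag (imget P r' t)).toReal * vre u t ≤ vre (absMulVecUp n prec (magM n P) u) r' :=
  sum_le_absMulVecUp prec (x := fun r t => (IntervalD.mag (imget P r t)).toReal * vre u t)
    (fun r hr t ht => by rw [dre_magM P hr ht]) hr'

namespace CertTablesV

variable {TV : CertTablesV} {kitOf : ℕ → CoreKit} {wT : ℕ → Array Dyad} {sc : ScalarsV}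

/-! ### From the chunk Booleans to (R2), variant C -/

section Stage

variable {P : ℕ → CoreOut → Bool} {j L : ℕ} (hL : 0 < L)
  (hGR : ∀ q, q * L < TV.S j → TV.growthRangeC kitOf wT P j L q = true)
include hL hGR

variable (hω : ∀ k, 0 < (TV.toCertDataVW kitOf wT sc).ω j k)
include hω

omit hL hGR in
/-- **(R2), in-chunk pairs** (the in-chunk factor is v1's). [folklore] -/
theorem hR2_inChunkC {s₀ s₁ : ℕ} (h01 : s₀ ≤ s₁) (hin : s₁ ≤ (s₀ / L + 1) * L) (Ac : ℕ → Ker)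
    (hA : ∀ s', s₀ ≤ s' → s' < s₁ →
      KerMem (TV.toCertDataVW kitOf wT sc) (Ac s') ((TV.toBoxesW kitOf wT).Mlo j s') ((TV.toBoxesW kitOf wT).Mhi j s'))
    (v : Fin 4 → ℤ → ℝ) (r : ℝ) (hr : 0 ≤ r) (hv : (TV.toCertDataVW kitOf wT sc).InBall j v r) :
    (TV.toCertDataVW kitOf wT sc).InBall j (kiter (TV.toCertDataVW kitOf wT sc) Ac s₀ (s₁ - s₀) v)
      (TV.GrC kitOf wT j L s₀ s₁ * r) := by
  unfold GrC gDC
  rw [if_pos hin]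
  refine TV.base.inBall_kiter_of_memMat cd_Kb cd_Ka
    (memMat_prodM (sc := sc) (s₁ - s₀) fun s' h1 h2 => hA s' h1 (by omega)) (fun r' hr' => ?_) hr hv
  exact (rowsum_omega_le_ωhi (sc := sc) (j := j) _ hr').trans (rowsum_le_facOf (sc := sc) j L _ hω _ _ hr')

omit hω in
/-- **TRANSPORT TO A LATER CHUNK START (variant C)**: for `s₀ < qL` (so `s₀/L < q`) with `qL < S`, an admissible chain from `s₀`
over `qL − s₀` sub-steps maps the `r·ω`-ball into the box `r · wVecC j L q s₀` (coordinatewise). [folklore] -/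
theorem transport_boundC {s₀ q : ℕ} (hsq : s₀ < q * L) (hq : q * L < TV.S j) (Ac : ℕ → Ker)
    (hA : ∀ s', s₀ ≤ s' → s' < q * L →
      KerMem (TV.toCertDataVW kitOf wT sc) (Ac s') ((TV.toBoxesW kitOf wT).Mlo j s') ((TV.toBoxesW kitOf wT).Mhi j s'))
    (v : Fin 4 → ℤ → ℝ) (r : ℝ) (hr : 0 ≤ r) (hv : (TV.toCertDataVW kitOf wT sc).InBall j v r) :
    AbsLeW (TV.toCertDataVW kitOf wT sc) (kiter (TV.toCertDataVW kitOf wT sc) Ac s₀ (q * L - s₀) v)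
      (fun i k => r * vre (TV.wVecC j L q s₀) (TV.base.idx i k)) := by
  -- the chunk `c` of `s₀` and the number `m` of whole chunks between it and chunk `q` (linear bookkeeping for `omega`)
  obtain ⟨c, hc⟩ : ∃ c, s₀ / L = c := ⟨_, rfl⟩
  have h1 : c * L ≤ s₀ := hc ▸ Nat.div_mul_le_self s₀ L
  have h2 : s₀ < c * L + L := hc ▸ Nat.lt_div_mul_add hL
  have hcq : c < q := hc ▸ (Nat.div_lt_iff_lt_mul hL).2 hsq
  obtain ⟨m, hm⟩ := Nat.exists_eq_add_of_lt hcq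
  have hX : (c + 1) * L = c * L + L := add_one_mul c L
  have hQ : q * L = (c + 1) * L + m * L := by rw [hm]; ring
  have hlater : (c + 1) * L < TV.S j := by omega
  have hcS : c * L < TV.S j := by omega
  -- LEG 1: the rest of chunk `c`, by the verified start-vector claim `ũ_{s₀}`
  have hmem1 := memMat_prodM (sc := sc) (j := j) (a := s₀) (A := Ac) ((c + 1) * L - s₀)
    fun s' h1' h2' => hA s' h1' (by omega)
  have hK1 := TV.base.kerMem_of_memMat_kiter cd_Kb cd_Ka hmem1
  have hb1 := absLeW_kiter_of_prodMem hK1 (v := v) (b := fun i k => r * (TV.toCertDataVW kitOf wT sc).ω j k)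
    (fun i k hk1 hk2 => hv i k hk1 hk2)
  have hcl := (claimsC_sound (TV := TV) (kitOf := kitOf) (wT := wT) (hGR c hcS) hL hlater).2 s₀ h1 (by omega)
  have hleg1 : AbsLeW (TV.toCertDataVW kitOf wT sc)
      (kiter (TV.toCertDataVW kitOf wT sc) Ac s₀ ((c + 1) * L - s₀) v) (fun i k => r * vre (TV.gU j s₀) (TV.base.idx i k)) := by
    intro i' k' hk1' hk2'
    refine (hb1 i' k' hk1' hk2').trans ?_
    have hrow : ∀ r' < TV.base.n, ∑ t ∈ Finset.range TV.base.n,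
        (IntervalD.mag (imget (TV.prodM kitOf wT j s₀ ((c + 1) * L - s₀)) r' t)).toReal *
          (r * (TV.toCertDataVW kitOf wT sc).ω j (TV.base.wk t)) ≤ r * vre (TV.gU j s₀) r' := by
      intro r' hr'
      have e : ∑ t ∈ Finset.range TV.base.n, (IntervalD.mag (imget (TV.prodM kitOf wT j s₀ ((c + 1) * L - s₀)) r' t)).toReal *
            (r * (TV.toCertDataVW kitOf wT sc).ω j (TV.base.wk t))
          = r * ∑ t ∈ Finset.range TV.base.n, (IntervalD.mag (imget (TV.prodM kitOf wT j s₀ ((c + 1) * L - s₀)) r' t)).toReal *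
            (TV.toCertDataVW kitOf wT sc).ω j (TV.base.wk t) := by
        rw [Finset.mul_sum]; exact Finset.sum_congr rfl fun t _ => by ring
      rw [e]
      refine mul_le_mul_of_nonneg_left ?_ hr
      refine (rowsum_omega_le_ωhi (sc := sc) (j := j) _ hr').trans ?_
      exact (sum_le_absMulVecUp TV.prec (fun r hr t ht => by rw [dre_magM _ hr ht]) hr').trans (hcl r' hr')
    have hw := TV.base.rowsum_window_le_of_coord cd_Kb cd_Ka (TV.prodM kitOf wT j s₀ ((c + 1) * L - s₀))
      (fun t => r * (TV.toCertDataVW kitOf wT sc).ω j (TV.base.wk t)) (fun r' => r * vre (TV.gU j s₀) r') hrow i' hk1' hk2'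
    refine le_trans (le_of_eq (Finset.sum_congr rfl fun c' _ => ?_)) hw
    rw [TV.base.wk_idx _ (by rw [← cd_Kb (TV := TV) (kitOf := kitOf) (wT := wT) (sc := sc),
      ← cd_Ka (TV := TV) (kitOf := kitOf) (wT := wT) (sc := sc)]; exact shellOf_mem _ c')]
  -- LEG 2: the `m` whole chunks `c+1, …, q−1` as ONE kernel in `RS j q m`
  have hmq : m ≤ q := by omega
  have hqm : q - m = c + 1 := by omega
  have hmem2 := memMat_RS (sc := sc) hL hGR hq Ac m hmq (fun s' h1' h2' => hA s' (by rw [hqm] at h1'; omega) h2')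
  rw [hqm] at hmem2
  have hK2 := TV.base.kerMem_of_memMat_kiter cd_Kb cd_Ka hmem2
  have hb2 := absLeW_kiter_of_prodMem hK2 hleg1
  -- compose the two legs
  have e1 : (c + 1) * L - s₀ + m * L = q * L - s₀ := by omega
  have hsplit : kiter (TV.toCertDataVW kitOf wT sc) Ac s₀ (q * L - s₀) v =
      kiter (TV.toCertDataVW kitOf wT sc) Ac ((c + 1) * L) (m * L)
        (kiter (TV.toCertDataVW kitOf wT sc) Ac s₀ ((c + 1) * L - s₀) v) := by
    rw [← e1, kiter_add]
    congr 1; omega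
  have em : q - 1 - s₀ / L = m := by omega
  have hWeq : TV.wVecC j L q s₀ = absMulVecUp TV.base.n TV.prec (magM TV.base.n (TV.RS j q m)) (TV.gU j s₀) := by
    unfold wVecC; rw [em]
  intro i' k' hk1' hk2'
  rw [hsplit, hWeq]
  refine (hb2 i' k' hk1' hk2').trans ?_
  have hrow : ∀ r' < TV.base.n, ∑ t ∈ Finset.range TV.base.n,
      (IntervalD.mag (imget (TV.RS j q m) r' t)).toReal * (r * vre (TV.gU j s₀) t) ≤
        r * vre (absMulVecUp TV.base.n TV.prec (magM TV.base.n (TV.RS j q m)) (TV.gU j s₀)) r' := by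
    intro r' hr'
    have e : ∑ t ∈ Finset.range TV.base.n, (IntervalD.mag (imget (TV.RS j q m) r' t)).toReal * (r * vre (TV.gU j s₀) t) =
        r * ∑ t ∈ Finset.range TV.base.n, (IntervalD.mag (imget (TV.RS j q m) r' t)).toReal * vre (TV.gU j s₀) t := by
      rw [Finset.mul_sum]; exact Finset.sum_congr rfl fun t _ => by ring
    rw [e]
    exact mul_le_mul_of_nonneg_left (sum_mag_le_absMulVecUp TV.prec (TV.RS j q m) (TV.gU j s₀) hr') hr
  exact TV.base.rowsum_window_le_of_coord cd_Kb cd_Ka _ (fun t => r * vre (TV.gU j s₀) t)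
    (fun r' => r * vre (absMulVecUp TV.base.n TV.prec (magM TV.base.n (TV.RS j q m)) (TV.gU j s₀)) r') hrow i' hk1' hk2'

/-- **(R2), cross-chunk pairs (variant C).** [folklore] -/
theorem hR2_crossC {s₀ s₁ : ℕ} (hS : s₁ ≤ TV.S j) (hout : ¬ s₁ ≤ (s₀ / L + 1) * L) (Ac : ℕ → Ker)
    (hA : ∀ s', s₀ ≤ s' → s' < s₁ →
      KerMem (TV.toCertDataVW kitOf wT sc) (Ac s') ((TV.toBoxesW kitOf wT).Mlo j s') ((TV.toBoxesW kitOf wT).Mhi j s'))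
    (v : Fin 4 → ℤ → ℝ) (r : ℝ) (hr : 0 ≤ r) (hv : (TV.toCertDataVW kitOf wT sc).InBall j v r) :
    (TV.toCertDataVW kitOf wT sc).InBall j (kiter (TV.toCertDataVW kitOf wT sc) Ac s₀ (s₁ - s₀) v)
      (TV.GrC kitOf wT j L s₀ s₁ * r) := by
  have h2 : s₀ < s₀ / L * L + L := Nat.lt_div_mul_add hL
  push Not at hout
  set qb := (s₁ - 1) / L with hqb
  have hb1 : qb * L ≤ s₁ - 1 := Nat.div_mul_le_self _ L
  have hb2 : s₁ - 1 < qb * L + L := Nat.lt_div_mul_add hL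
  have hq : s₀ / L + 1 ≤ qb := (Nat.le_div_iff_mul_le hL).2 (by omega)
  have hX : (s₀ / L + 1) * L = s₀ / L * L + L := add_one_mul _ L
  have hsq : s₀ < qb * L := by
    have : (s₀ / L + 1) * L ≤ qb * L := Nat.mul_le_mul_right L hq
    omega
  have hqS : qb * L < TV.S j := by omega
  have ht := transport_boundC (TV := TV) (kitOf := kitOf) (wT := wT) (sc := sc) hL hGR hsq hqS Ac
    (fun s' h1' h2' => hA s' h1' (by omega)) v r hr hv
  -- split at `qb·L`
  have e1 : s₁ - s₀ = (qb * L - s₀) + (s₁ - qb * L) := by omega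
  rw [e1, kiter_add, show s₀ + (qb * L - s₀) = qb * L by omega]
  have hmem := memMat_prodM (sc := sc) (j := j) (a := qb * L) (A := Ac) (s₁ - qb * L) fun s' h1' h2' =>
    hA s' (by omega) (by omega)
  have hK := TV.base.kerMem_of_memMat_kiter cd_Kb cd_Ka hmem
  have hb := absLeW_kiter_of_prodMem hK ht
  unfold GrC gDC
  rw [if_neg (by omega)]
  intro i k hk1 hk2
  refine (hb i k hk1 hk2).trans ?_
  have hrow : ∀ r' < TV.base.n, ∑ t ∈ Finset.range TV.base.n,
      (IntervalD.mag (imget (TV.prodM kitOf wT j (qb * L) (s₁ - qb * L)) r' t)).toReal * (r * vre (TV.wVecC j L qb s₀) t) ≤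
      ((TV.gctx j L ((s₁ - 1) / L)).facOf (TV.prodM kitOf wT j ((s₁ - 1) / L * L) (s₁ - (s₁ - 1) / L * L))
          (TV.wVecC j L ((s₁ - 1) / L) s₀)).toReal * r * (TV.toCertDataVW kitOf wT sc).ω j (TV.base.wk r') := by
    intro r' hr'
    have e : ∑ t ∈ Finset.range TV.base.n,
        (IntervalD.mag (imget (TV.prodM kitOf wT j (qb * L) (s₁ - qb * L)) r' t)).toReal * (r * vre (TV.wVecC j L qb s₀) t) =
        r * ∑ t ∈ Finset.range TV.base.n,
          (IntervalD.mag (imget (TV.prodM kitOf wT j (qb * L) (s₁ - qb * L)) r' t)).toReal * vre (TV.wVecC j L qb s₀) t := by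
      rw [Finset.mul_sum]; exact Finset.sum_congr rfl fun t _ => by ring
    rw [e, ← hqb]
    have hf := rowsum_le_facOf (sc := sc) j L qb hω (TV.prodM kitOf wT j (qb * L) (s₁ - qb * L)) (TV.wVecC j L qb s₀) hr'
    calc r * _ ≤ r * (((TV.gctx j L qb).facOf (TV.prodM kitOf wT j (qb * L) (s₁ - qb * L)) (TV.wVecC j L qb s₀)).toReal *
          (TV.toCertDataVW kitOf wT sc).ω j (TV.base.wk r')) := mul_le_mul_of_nonneg_left hf hr
      _ = _ := by ring
  have hw := TV.base.rowsum_window_le_of_coord cd_Kb cd_Ka _ (fun t => r * vre (TV.wVecC j L qb s₀) t) _ hrow i hk1 hk2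
  refine hw.trans (le_of_eq ?_)
  rw [TV.base.wk_idx i (by rw [← cd_Kb (TV := TV) (kitOf := kitOf) (wT := wT) (sc := sc),
    ← cd_Ka (TV := TV) (kitOf := kitOf) (wT := wT) (sc := sc)]; exact ⟨hk1, hk2⟩)]

/-- **(R2) from the variant-C growth Booleans** (all pairs `s₀ ≤ s₁ ≤ S`). [folklore] -/
theorem hR2_of_growthC (s₀ s₁ : ℕ) (h01 : s₀ ≤ s₁) (hS : s₁ ≤ TV.S j) (Ac : ℕ → Ker)
    (hA : ∀ s', s₀ ≤ s' → s' < s₁ →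
      KerMem (TV.toCertDataVW kitOf wT sc) (Ac s') ((TV.toBoxesW kitOf wT).Mlo j s') ((TV.toBoxesW kitOf wT).Mhi j s'))
    (v : Fin 4 → ℤ → ℝ) (r : ℝ) (hr : 0 ≤ r) (hv : (TV.toCertDataVW kitOf wT sc).InBall j v r) :
    (TV.toCertDataVW kitOf wT sc).InBall j (kiter (TV.toCertDataVW kitOf wT sc) Ac s₀ (s₁ - s₀) v)
      (TV.GrC kitOf wT j L s₀ s₁ * r) := by
  by_cases hin : s₁ ≤ (s₀ / L + 1) * L
  · exact hR2_inChunkC (sc := sc) hω h01 hin Ac hA v r hr hv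
  · exact hR2_crossC (sc := sc) hL hGR hω hS hin Ac hA v r hr hv

end Stage

/-! ### Variant C: the composer's inputs for all stages -/

section All

variable {L : ℕ} (hL : 0 < L) {Pj : ℕ → ℕ → CoreOut → Bool}
  (hGR : ∀ j, j ≤ TV.base.N₀ → ∀ q, q * L < TV.S j → TV.growthRangeC kitOf wT (Pj j) j L q = true)
  (hcL : ∀ j, j ≤ TV.base.N₀ → TV.checkL1 j = true)
  (hSN : (TV.toCertDataVW kitOf wT sc).StageNumerics)

include hL hGR hSN in
/-- (R2) for all stages (variant C). [folklore] -/
theorem hR2_allC : ∀ j, j ≤ TV.base.N₀ → ∀ s₀ s₁, s₀ ≤ s₁ → s₁ ≤ (TV.toCertDataVW kitOf wT sc).S j → ∀ Ac : ℕ → Ker,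
    (∀ s', s₀ ≤ s' → s' < s₁ →
      KerMem (TV.toCertDataVW kitOf wT sc) (Ac s') ((TV.toBoxesW kitOf wT).Mlo j s') ((TV.toBoxesW kitOf wT).Mhi j s')) →
    ∀ (v : Fin 4 → ℤ → ℝ) (r : ℝ), 0 ≤ r → (TV.toCertDataVW kitOf wT sc).InBall j v r →
      (TV.toCertDataVW kitOf wT sc).InBall j (kiter (TV.toCertDataVW kitOf wT sc) Ac s₀ (s₁ - s₀) v)
        (TV.GrC kitOf wT j L s₀ s₁ * r) :=
  fun j hj s₀ s₁ h01 hS Ac hA v r hr hv =>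
    hR2_of_growthC (sc := sc) hL (hGR j hj) (hSN.1 j hj).2.2.2.2.2.2.1 s₀ s₁ h01 hS Ac hA v r hr hv

include hL hGR in
/-- (R3a) for all stages (variant C). [folklore] -/
theorem hR3a_allC : ∀ j, j ≤ TV.base.N₀ → ∀ a b, a < (TV.toCertDataVW kitOf wT sc).S j → a + 1 ≤ b →
    b ≤ (TV.toCertDataVW kitOf wT sc).S j →
    (TV.toCertDataVW kitOf wT sc).L1 j a * TV.GrC kitOf wT j L (a + 1) b ≤ TV.ΛTr j ∧
    (b < (TV.toCertDataVW kitOf wT sc).S j →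
      (TV.toCertDataVW kitOf wT sc).L1 j a * TV.GrC kitOf wT j L (a + 1) b * (TV.toCertDataVW kitOf wT sc).L1 j b ≤
        (TV.toCertDataVW kitOf wT sc).Λ j) :=
  fun j hj a b ha hab hb => hR3a_of_growthC (sc := sc) hL (hGR j hj) a b ha hab hb

omit hGR in
include hL hcL in
/-- (R3b) for all stages (variant C). [folklore] -/
theorem hR3b_allC
    (hGR : ∀ j, j ≤ TV.base.N₀ → ∀ q, q * L < TV.S j → TV.growthRangeC kitOf wT (Pj j) j L q = true) :
    ∀ j, j ≤ TV.base.N₀ → ∀ a, a < (TV.toCertDataVW kitOf wT sc).S j →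
    (TV.toCertDataVW kitOf wT sc).L1 j a ≤ (TV.toCertDataVW kitOf wT sc).Λ j :=
  fun j hj a ha => hR3b_of_growthC (sc := sc) hL (hGR j hj) (hcL j hj) a ha

omit hGR in
include hL in
/-- The variant-C chunk runs also deliver the chain Booleans (`ChecksOK.steps`) and the caller's per-sub-step predicate.
[folklore] -/
theorem steps_of_growthC
    (hGR : ∀ j, j ≤ TV.base.N₀ → ∀ q, q * L < TV.S j → TV.growthRangeC kitOf wT (Pj j) j L q = true) :
    ∀ j, j ≤ TV.base.N₀ → ∀ s, s < TV.S j →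
    ((TV.ctxOfW kitOf wT j).subStep s ((TV.ctxOfW kitOf wT j).nodeAt s)).ok = true ∧
    Pj j s ((TV.ctxOfW kitOf wT j).subStep s ((TV.ctxOfW kitOf wT j).nodeAt s)).core = true := by
  intro j hj s hs
  obtain ⟨h1, h2, -⟩ := facts_atC (TV := TV) (kitOf := kitOf) (wT := wT) hL (hGR j hj) hs
  exact ⟨h1, h2⟩

end All

end CertTablesV

end Summit.NavierStokesRegularity.NavierStokesRegularity.Theorems.TaylorModelCert
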